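import Literature.NumberTheory.ComplexMultiplication.CosetGermGaloisSetting
import Literature.NumberTheory.ComplexMultiplication.CosetGermAlmostCartesianSquare
import HarnessLib

/-!
# Milne 1999 §6 p. 69: Lemma 5.1's commutative diagram in the Galois coordinates —
# «`X^*(S^K) —natural inclusion→ ℤ[Γ]`», «`X^*(P^K) —(π ↦ f_π)→ ℤ[Γ/D]`», `X^*(α^K)` and «`Σ f(τ)τ ↦ Σ f(τ)(τD)`»;
# `X^*(S^K) ≅ serreLattice`, `X^*(P^K) ≅ weilLattice`, and `X^*(α^K)` = the model's `alphaP`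
# (J. S. Milne, *Lefschetz motives and the Tate conjecture*, Compositio Math. 117 (1999), §6 p. 69 L16–L21; §5 p. 63 (5.1), Rem. 5.2)

Family `hodge`, lane `lit-hodgefound` (Layer A3; seat `lit-hodgefound-p27`, generation 18, row g18-#2); topic
`Literature/NumberTheory/ComplexMultiplication`, namespace `Literature.NumberTheory.ComplexMultiplication.CMNumbers`.  Sequel of g18-#1
`CosetGermGaloisSetting` (`Γ = Gal(K/ℚ)`, `ι = conjGal`, `D = D(w₀) = decompositionGroup p 𝔭`, `Γ/D ≅ Y` via `τ ↦ τw₀` =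
`cosetsEquivPrimesOver`).  THE DICTIONARY between the NUMBER-THEORETIC character modules of g16 — `X^*(S^K) = infinityTypes` on
`Hom(K, ℚ^{cm})` (skel-3), `X^*(P^K) = W^K(p^∞) = weilLimitIn K p τ₀` (g16-#3), `X^*(α^K) = alphaCharIn` (g16-#3), `[π] ↦ f_π = fInvLim`
(g16-#3) — and the GROUP-RING MODEL of g17 — `serreLattice ι ℤ ⊂ ℤ[Γ]`, `weilLattice ι D ℤ ⊂ ℤ[Γ/D]`, `alphaP` (g17-#3), `pushFun`
(g16-#6) — along Milne's identifications `Hom(K, ℚ^{al}) = Γ` (through the inclusion `τ₀ : K ⊂ ℚ^{al}`; g16-#2 `embOfAut`/`autEquivEmb`)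
and `Γ/D = Y`.  Small carriers with bodies (`toGroupRing`, `toSerreLattice`, `serreLatticeEquiv`, `germToCosetAddHom`/`germToCosetFun`,
`toWeilLattice`, `weilLatticeEquiv`) + THEOREMS; no named fact (D-0026, net debt 0).  Nothing here is a case of the Hodge conjecture.

THE PRINT.  [Milne1999] §6 p. 69 L16–L21 (held `paper:doi-10-1023-a-1000776613765` p0025 L32–L54), verbatim: «We shall use the map `τ ↦ τw₀`
to identify `Γ/D` with the set of primes of `K` lying over `p`. We have a commutative diagram (Lemma 5.1):
`X^*(S^K) —natural inclusion→ ℤ[Γ]`, `X^*(P^K) —(π ↦ f_π)→ ℤ[Γ/D]` [with vertical maps `X^*(S^K) → X^*(P^K)` and `ℤ[Γ] → ℤ[Γ/D]`].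
The first vertical map is `X^*(α^K)`, which maps `f` to `π(f)`, and the second is `Σ f(τ)τ ↦ Σ f(τ)(τD)`.»  Tools, §5 p. 63:
(5.1) «`f_{g(ϖ)}(w) = Σ_{τw₀ = w} g(τ) ∈ ℤ`»; LEMMA 5.1 («the maps `X^*(S^K) → W^K(p^∞) → {f : Y → ℤ | f + ιf ∈ [K_{w₀} : ℚ_p]ℤ}` are
surjective»); REMARK 5.2 (a) («`α^K : P^K → S^K` is injective»), (b) («`[π] ↦ f_π : X^*(P^K) → {f : Y → ℤ | …}` is an isomorphism»);
§6 p. 70 L9–L10 «The map at right sends `π` to the map `σ ↦ f_π(σw₀)`—it is injective (Section 4)».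

DICTIONARY.  `K` CM, Galois over `ℚ`; `τ₀ : K →ₐ[ℚ] ℚ^{cm}` Milne's inclusion `K ⊂ ℚ^{al}` (`cmNumbers`); `Γ = K ≃ₐ[ℚ] K`; `Hom(K, ℚ^{al})`
= `K →ₐ[ℚ] cmNumbers = {τ₀σ | σ ∈ Γ}` (`embOfAut τ₀`, bijective: `autEquivEmb τ₀`), acted on by `Gal(ℚ^{cm}/ℚ)` by composition and by
`ι_{cm} = cmNumbersConj` with `ι_{cm} ∘ τ₀σ = τ₀ ∘ ισ` (g16-#3 `cmNumbersConj_smul_embOfAut`).  «natural inclusion `X^*(S^K) → ℤ[Γ]`» =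
`toGroupRing τ₀ : (Hom(K, ℚ^{cm}) → ℤ) →ₗ[ℤ] (Γ →₀ ℤ)`, `g ↦ Σ_σ g(τ₀σ)σ`, restricted to `X^*(S^K) = infinityTypes (Gal(ℚ^{cm}/ℚ))
(Hom(K, ℚ^{cm})) ι_{cm}` (skel-3's (1.1), `g + ιg` constant); its image is EXACTLY g17-#3's `serreLattice conjGal ℤ = {f | f(γ) + f(ιγ) =
f(1) + f(ι)}` (`toGroupRing_mem_serreLattice_iff`), whence `serreLatticeEquiv : X^*(S^K) ≃ₗ[ℤ] serreLattice conjGal ℤ`.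
«`π ↦ f_π : X^*(P^K) → ℤ[Γ/D]`» = `germToCosetFun : Additive (weilLimitIn K p τ₀) →ₗ[ℤ] (Γ ⧸ D →₀ ℤ)`, `[π] ↦ Σ_{τD} f_π(τw₀)·τD`
(g16-#3 `fInvLim` composed with g18-#1 `cosetsEquivPrimesOver : Γ/D ≃ Y`; «the map … sends `π` to the map `σ ↦ f_π(σw₀)`»); injective
(`germToCosetFun_injective`, «it is injective (Section 4)»), with image EXACTLY g17-#3's `weilLattice conjGal D ℤ` (`range_germToCosetFun`,
by Lemma 5.1 / Remark 5.2), whence `weilLatticeEquiv : X^*(P^K) ≃ₗ[ℤ] weilLattice conjGal D ℤ`.  «the second [vertical map] is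
`Σ f(τ)τ ↦ Σ f(τ)(τD)`» = g16-#6's `OrbitTorus.pushFun ℤ ((↑) : Γ → Γ ⧸ D)` (value at `τD` = `Σ_{δ ∈ τD} f(δ)`, g17-#3 `pushFun_apply_coe`);
«The first vertical map is `X^*(α^K)`» = g16-#3 `alphaCharIn p 𝔭 τ₀ : X^*(S^K) →ₗ[ℤ] X^*(P^K)` (`g ↦ π(g) = [g(ϖ)]`).

WHAT IS HERE (all PROVED):
* §1 DEF **`toGroupRing τ₀`** (`toGroupRing_apply`, **`toGroupRing_bijective`**), **`toGroupRing_mem_serreLattice_iff`** (`Σ g(τ₀σ)σ ∈ serreLattice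
  ⟺ g ∈ X^*(S^K)`), `toGroupRing_mem_serreLattice`, DEF `toSerreLattice` (`coe_toSerreLattice`, `toSerreLattice_bijective`), DEF
  **`serreLatticeEquiv : X^*(S^K) ≃ₗ[ℤ] serreLattice conjGal ℤ`** (`coe_serreLatticeEquiv`).
* §2 DEF `germToCosetAddHom`, DEF **`germToCosetFun`** (**`germToCosetFun_apply_mk : (τD) ↦ f_π(τw₀)`**, `germToCosetFun_apply`),
  **`germToCosetFun_injective`**, **`toAdd_fInvLim_alphaCharIn`** ((5.1) for `π(g)`: `f_{π(g)}(w) = Σ_{σw₀ = w} g(τ₀σ)`).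
* §3 `coe_eq_coe_iff_smul_eq` (`σD = τD ⟺ σw₀ = τw₀`), **`pushFun_toGroupRing`** — THE DIAGRAM COMMUTES: `push(Σ g(τ₀σ)σ) = (f_{π(g)} on Γ/D)` for
  `g ∈ X^*(S^K)` —, `alphaS_serreLatticeEquiv`, **`range_germToCosetFun`** (`= weilLattice`), `germToCosetFun_mem_weilLattice`, DEF `toWeilLattice`
  (`coe_toWeilLattice`, `toWeilLattice_bijective`), DEF **`weilLatticeEquiv : X^*(P^K) ≃ₗ[ℤ] weilLattice conjGal D ℤ`** (`coe_weilLatticeEquiv`),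
  **`weilLatticeEquiv_alphaCharIn : weilLatticeEquiv (X^*(α^K) g) = alphaP (serreLatticeEquiv g)`**, `weilLatticeEquiv_comp_alphaCharIn` — under
  the identifications, `X^*(α^K)` of the CM field `K` IS the model's `alphaP`, so g17-#3's kernel computation (`alphaS_eq_zero_iff`, proof of
  Lemma 6.9) and everything g17-#3…#5 prove about `alphaP` are statements about `α^K : P^K → S^K`.

NOT here: the analogous dictionaries for `X^*(T^Ψ)`, `X^*(L^Π)` (CM types `Φ ⊂ Hom(K, ℚ^{cm})` of g16-#6 vs the model's CM types `⊂ Γ` of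
g17-#4, Weil germs `Π`) and for `γ`, `β`, `α′`, which would transport g17-#5's `exact_pairProduct` (Theorem 6.1 at level `K` on characters)
to the CM field `K` verbatim; the `Γ`-equivariance of `toGroupRing` (restriction `Gal(ℚ^{cm}/ℚ) → Gal(K/ℚ)`); THEOREM 6.1 on group schemes
and the limit over `K` (Layer B, B5-09).

## References

* [Milne1999] J. S. Milne, *Lefschetz motives and the Tate conjecture*, Compositio Math. 117 (1999) 45–76 — §6 p. 69 L16–L21, p. 70 L9–L10;
  §5 p. 63 (5.1), Lemma 5.1, Remark 5.2 (held `paper:doi-10-1023-a-1000776613765` p0025 L32–L54, p0026 L9–L10, p0019).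

Provenance: lane `lit-hodgefound`, seat `lit-hodgefound-p27` gen 18 (agent `literature-prover-lit-hodgefound-p27-g18-0`), row g18-#2.
-/

set_option autoImplicit false

noncomputable section

open scoped NumberField Pointwise

namespace Literature.NumberTheory.ComplexMultiplication

namespace CMNumbers

open _root_.NumberField IntermediateField Finset
open Literature.NumberTheory.NumberFields (cmNumbers cmNumbersConj cmNumbersConj_mul_self cmNumbersConj_comm)
open OrbitTorus (pushFun)
open CosetGerm (serreLattice weilLattice alphaS alphaP mem_serreLattice_iff)

/-! ### §1 «`X^*(S^K) —natural inclusion→ ℤ[Γ]`»: functions on `Hom(K, ℚ^{cm}) = τ₀ ∘ Γ` as elements of `ℤ[Γ]` -/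

section GroupRing

variable {K : Type} [Field K] [NumberField K] [IsCMField K] [IsGalois ℚ K] (τ₀ : K →ₐ[ℚ] cmNumbers)

/-- **The natural map `(functions on Hom(K, ℚ^{cm})) → ℤ[Γ]`**, `g ↦ Σ_σ g(τ₀σ)·σ`: Milne identifies `Hom(K, ℚ^{al})` with `Γ = Gal(K/ℚ)`
through the inclusion `K ⊂ ℚ^{al}` (here `τ₀`, g16-#2 `embOfAut τ₀ σ = τ₀ ∘ σ`), under which `X^*(K^×) = ℤ[Γ]` and `X^*(S^K) ⊂ ℤ[Γ]`
(«natural inclusion»). [cite: Milne1999, §6 p. 69 L18–L19] -/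
def toGroupRing : ((K →ₐ[ℚ] cmNumbers) → ℤ) →ₗ[ℤ] ((K ≃ₐ[ℚ] K) →₀ ℤ) where
  toFun g := Finsupp.equivFunOnFinite.symm fun σ => g (embOfAut τ₀ σ)
  map_add' g g' := by ext σ; simp
  map_smul' n g := by ext σ; simp

omit [IsCMField K] [IsGalois ℚ K] in
/-- `(Σ_σ g(τ₀σ)σ)(σ) = g(τ₀σ)`. [cite: Milne1999, §6 p. 69 L18–L19] -/
@[simp] theorem toGroupRing_apply (g : (K →ₐ[ℚ] cmNumbers) → ℤ) (σ : K ≃ₐ[ℚ] K) : toGroupRing τ₀ g σ = g (embOfAut τ₀ σ) := rfl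

omit [IsCMField K] in
/-- `g ↦ Σ g(τ₀σ)σ` is a bijection `(Hom(K, ℚ^{cm}) → ℤ) ≅ ℤ[Γ]` (`σ ↦ τ₀σ` is a bijection for `K` Galois, g16-#2 `autEquivEmb`).
[cite: Milne1999, §6 p. 69 L18–L19] -/
theorem toGroupRing_bijective : Function.Bijective (toGroupRing τ₀) := by
  constructor
  · intro g g' h
    funext x
    obtain ⟨σ, rfl⟩ := (autEquivEmb τ₀).surjective x
    have := Finsupp.ext_iff.1 h σ
    simpa using this
  · intro F
    refine ⟨fun x => F ((autEquivEmb τ₀).symm x), ?_⟩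
    ext σ
    rw [toGroupRing_apply, ← autEquivEmb_apply, Equiv.symm_apply_apply]

/-- **«natural inclusion»: `X^*(S^K) ⊂ ℤ[Γ]` IS g17-#3's `serreLattice`** — a function `g` on `Hom(K, ℚ^{cm})` satisfies skel-3's (1.1)
(`g ∈ infinityTypes`, i.e. `g ∈ X^*(S^K)`: `g + ιg` constant) iff `Σ g(τ₀σ)σ` satisfies `f(γ) + f(ιγ) = f(1) + f(ι)` (`ι_{cm} ∘ τ₀σ = τ₀ ∘ ισ`,
g16-#3 `cmNumbersConj_smul_embOfAut`; `Gal(ℚ^{cm}/ℚ)` is transitive on `Hom(K, ℚ^{cm})`). [cite: Milne1999, §6 p. 69 L18–L19, §5 p. 62 L33–L34] -/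
theorem toGroupRing_mem_serreLattice_iff (g : (K →ₐ[ℚ] cmNumbers) → ℤ) :
    toGroupRing τ₀ g ∈ serreLattice (conjGal : K ≃ₐ[ℚ] K) ℤ ↔
      g ∈ infinityTypes (cmNumbers ≃ₐ[ℚ] cmNumbers) (K →ₐ[ℚ] cmNumbers) cmNumbersConj := by
  have hinv : cmNumbersConj⁻¹ = cmNumbersConj := inv_eq_of_mul_eq_one_right cmNumbersConj_mul_self
  have hcomm : ∀ (σ : cmNumbers ≃ₐ[ℚ] cmNumbers) (x : K →ₐ[ℚ] cmNumbers), σ • cmNumbersConj • x = cmNumbersConj • σ • x :=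
    fun σ x => AlgHom.ext fun y => by simp only [algEquiv_smul_apply]; exact cmNumbersConj_comm σ (x y)
  rw [mem_serreLattice_iff, mem_infinityTypes_iff_of_comm hcomm, hinv]
  have hι : ∀ σ : K ≃ₐ[ℚ] K, embOfAut τ₀ (conjGal * σ) = cmNumbersConj • embOfAut τ₀ σ :=
    fun σ => (cmNumbersConj_smul_embOfAut τ₀ σ).symm
  have hι1 : embOfAut τ₀ (conjGal : K ≃ₐ[ℚ] K) = cmNumbersConj • τ₀ := by
    rw [← mul_one (conjGal : K ≃ₐ[ℚ] K), hι, embOfAut_one]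
  simp only [toGroupRing_apply, embOfAut_one, hι1, hι]
  constructor
  · intro hF σ' x
    obtain ⟨σ, rfl⟩ := (autEquivEmb τ₀).surjective x
    obtain ⟨σ'', h''⟩ := (autEquivEmb τ₀).surjective (σ' • embOfAut τ₀ σ)
    rw [autEquivEmb_apply] at h'' ⊢
    rw [← h'', hF σ'', hF σ]
  · intro hg γ
    obtain ⟨σ', h'⟩ := exists_algEquiv_smul_eq τ₀ (embOfAut τ₀ γ)
    rw [← h']
    exact hg σ' τ₀

/-- For `g ∈ X^*(S^K)`: `Σ g(τ₀σ)σ ∈ serreLattice`. [cite: Milne1999, §6 p. 69 L18–L19] -/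
theorem toGroupRing_mem_serreLattice (g : infinityTypes (cmNumbers ≃ₐ[ℚ] cmNumbers) (K →ₐ[ℚ] cmNumbers) cmNumbersConj) :
    toGroupRing τ₀ (g : (K →ₐ[ℚ] cmNumbers) → ℤ) ∈ serreLattice (conjGal : K ≃ₐ[ℚ] K) ℤ :=
  (toGroupRing_mem_serreLattice_iff τ₀ _).2 g.2

/-- The natural inclusion restricted: `X^*(S^K) → serreLattice` (`ℤ`-linear). [cite: Milne1999, §6 p. 69 L18–L19] -/
def toSerreLattice : infinityTypes (cmNumbers ≃ₐ[ℚ] cmNumbers) (K →ₐ[ℚ] cmNumbers) cmNumbersConj →ₗ[ℤ]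
    serreLattice (conjGal : K ≃ₐ[ℚ] K) ℤ :=
  ((toGroupRing τ₀).comp (Submodule.subtype _)).codRestrict _ (toGroupRing_mem_serreLattice τ₀)

/-- [cite: Milne1999, §6 p. 69 L18–L19] -/
@[simp] theorem coe_toSerreLattice (g : infinityTypes (cmNumbers ≃ₐ[ℚ] cmNumbers) (K →ₐ[ℚ] cmNumbers) cmNumbersConj) :
    (toSerreLattice τ₀ g : (K ≃ₐ[ℚ] K) →₀ ℤ) = toGroupRing τ₀ (g : (K →ₐ[ℚ] cmNumbers) → ℤ) := rfl

/-- `X^*(S^K) → serreLattice` is a bijection. [cite: Milne1999, §6 p. 69 L18–L19] -/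
theorem toSerreLattice_bijective : Function.Bijective (toSerreLattice τ₀) := by
  constructor
  · intro g g' h
    have h' := congrArg (fun f : serreLattice (conjGal : K ≃ₐ[ℚ] K) ℤ => (f : (K ≃ₐ[ℚ] K) →₀ ℤ)) h
    simp only [coe_toSerreLattice] at h'
    exact Subtype.ext ((toGroupRing_bijective τ₀).1 h')
  · intro F
    obtain ⟨g, hg⟩ := (toGroupRing_bijective τ₀).2 (F : (K ≃ₐ[ℚ] K) →₀ ℤ)
    have hmem : g ∈ infinityTypes (cmNumbers ≃ₐ[ℚ] cmNumbers) (K →ₐ[ℚ] cmNumbers) cmNumbersConj := by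
      rw [← toGroupRing_mem_serreLattice_iff τ₀, hg]; exact F.2
    exact ⟨⟨g, hmem⟩, Subtype.ext hg⟩

/-- **`X^*(S^K) ≅ serreLattice`** (`ℤ`-linear equivalence): skel-3's/g16's `X^*(S^K) = infinityTypes` on `Hom(K, ℚ^{cm})` IS the model's
`X^*(S^K) = CosetGerm.serreLattice conjGal ℤ ⊂ ℤ[Gal(K/ℚ)]` of g17-#3. [cite: Milne1999, §6 p. 69 L18–L19] -/
def serreLatticeEquiv : infinityTypes (cmNumbers ≃ₐ[ℚ] cmNumbers) (K →ₐ[ℚ] cmNumbers) cmNumbersConj ≃ₗ[ℤ]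
    serreLattice (conjGal : K ≃ₐ[ℚ] K) ℤ :=
  LinearEquiv.ofBijective (toSerreLattice τ₀) (toSerreLattice_bijective τ₀)

/-- [cite: Milne1999, §6 p. 69 L18–L19] -/
@[simp] theorem coe_serreLatticeEquiv (g : infinityTypes (cmNumbers ≃ₐ[ℚ] cmNumbers) (K →ₐ[ℚ] cmNumbers) cmNumbersConj) :
    (serreLatticeEquiv τ₀ g : (K ≃ₐ[ℚ] K) →₀ ℤ) = toGroupRing τ₀ (g : (K →ₐ[ℚ] cmNumbers) → ℤ) := rfl

end GroupRing

/-! ### §2 «`X^*(P^K) —(π ↦ f_π)→ ℤ[Γ/D]`»: `f_π` as a function on `Γ/D ≅ Y` -/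

section Germs

variable {K : Type} [Field K] [NumberField K] [IsCMField K] [IsGalois ℚ K]
variable (p : ℕ) [hp : Fact p.Prime] (𝔭 : Ideal (𝓞 K)) [h𝔭P : 𝔭.IsPrime] [h𝔭 : 𝔭.LiesOver (Ideal.span {(p : ℤ)})]
variable (τ₀ : K →ₐ[ℚ] cmNumbers)

/-- **«`π ↦ f_π : X^*(P^K) → ℤ[Γ/D]`»**: the germ invariants `f_π : Y → ℤ` of `[π] ∈ W^K(p^∞) = X^*(P^K)` (g16-#3 `fInvLim`) read as an
element `Σ_{τD} f_π(τw₀)·τD` of `ℤ[Γ/D]` through g18-#1's identification `Γ/D ≅ Y`, `τD ↦ τw₀` (`cosetsEquivPrimesOver`); `ℤ`-linear on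
`X^*(P^K)` written additively. [cite: Milne1999, §6 p. 69 L16–L21] -/
def germToCosetAddHom : Additive (weilLimitIn K p τ₀) →+ ((K ≃ₐ[ℚ] K) ⧸ decompositionGroup p 𝔭 →₀ ℤ) where
  toFun x := Finsupp.equivFunOnFinite.symm fun c => (fInvLim p τ₀ (Additive.toMul x)).toAdd (cosetsEquivPrimesOver p 𝔭 c)
  map_zero' := by
    ext c
    simp only [Finsupp.coe_equivFunOnFinite_symm, Finsupp.coe_zero, Pi.zero_apply, toMul_zero, map_one, toAdd_one]
  map_add' x y := by
    ext c
    simp only [Finsupp.coe_equivFunOnFinite_symm, Finsupp.coe_add, Pi.add_apply, toMul_add, map_mul, toAdd_mul]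

/-- `π ↦ f_π : X^*(P^K) → ℤ[Γ/D]`, `ℤ`-linear (see `germToCosetAddHom`). [cite: Milne1999, §6 p. 69 L16–L21] -/
def germToCosetFun : Additive (weilLimitIn K p τ₀) →ₗ[ℤ] ((K ≃ₐ[ℚ] K) ⧸ decompositionGroup p 𝔭 →₀ ℤ) :=
  (germToCosetAddHom p 𝔭 τ₀).toIntLinearMap

/-- `(f_π on Γ/D)(τD) = f_π(τw₀)`. [cite: Milne1999, §6 p. 69 L16–L21] -/
@[simp] theorem germToCosetFun_apply_mk (x : Additive (weilLimitIn K p τ₀)) (τ : K ≃ₐ[ℚ] K) :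
    germToCosetFun p 𝔭 τ₀ x (τ : (K ≃ₐ[ℚ] K) ⧸ decompositionGroup p 𝔭) =
      (fInvLim p τ₀ (Additive.toMul x)).toAdd (τ • basePrime p 𝔭) := by
  change (fInvLim p τ₀ (Additive.toMul x)).toAdd (cosetsEquivPrimesOver p 𝔭 (τ : (K ≃ₐ[ℚ] K) ⧸ decompositionGroup p 𝔭)) = _
  rw [cosetsEquivPrimesOver_mk]

/-- [cite: Milne1999, §6 p. 69 L16–L21] -/
theorem germToCosetFun_apply (x : Additive (weilLimitIn K p τ₀)) (c : (K ≃ₐ[ℚ] K) ⧸ decompositionGroup p 𝔭) :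
    germToCosetFun p 𝔭 τ₀ x c = (fInvLim p τ₀ (Additive.toMul x)).toAdd (cosetsEquivPrimesOver p 𝔭 c) := rfl

/-- **«`[π] ↦ f_π` … is injective» on `ℤ[Γ/D]`**: `X^*(P^K) → ℤ[Γ/D]` is injective (g16-#3 `fInvLim_injective`; `Γ/D ≅ Y`).
[cite: Milne1999, §6 p. 70 L9–L10 («it is injective (Section 4)»), §4 p. 61 L24–L25] -/
theorem germToCosetFun_injective : Function.Injective (germToCosetFun p 𝔭 τ₀) := by
  intro x y h
  have h' : ∀ w, (fInvLim p τ₀ (Additive.toMul x)).toAdd w = (fInvLim p τ₀ (Additive.toMul y)).toAdd w := by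
    intro w
    obtain ⟨c, rfl⟩ := (cosetsEquivPrimesOver p 𝔭).surjective w
    rw [← germToCosetFun_apply, ← germToCosetFun_apply, h]
  have h'' : fInvLim p τ₀ (Additive.toMul x) = fInvLim p τ₀ (Additive.toMul y) := Multiplicative.toAdd.injective (funext h')
  exact Additive.toMul.injective (fInvLim_injective p τ₀ h'')

/-- **(5.1) for `X^*(α^K)`**: `f_{π(g)}(w) = Σ_{σw₀ = w} g(τ₀σ)` for `g ∈ X^*(S^K)`, `π(g) = alphaCharIn g ∈ W^K(p^∞)` (g16-#2 `fInvHom_alphaUnitIn`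
on the representative `g(ϖ) ∈ W^K(p^{f h})`). [cite: Milne1999, §5 p. 63 display (5.1)] -/
theorem toAdd_fInvLim_alphaCharIn (g : infinityTypes (cmNumbers ≃ₐ[ℚ] cmNumbers) (K →ₐ[ℚ] cmNumbers) cmNumbersConj)
    (w : primesOverSet p K) :
    (fInvLim p τ₀ (Additive.toMul (alphaCharIn p 𝔭 τ₀ g))).toAdd w =
      ∑ σ ∈ univ.filter (fun σ : K ≃ₐ[ℚ] K => σ • basePrime p 𝔭 = w), (g : (K →ₐ[ℚ] cmNumbers) → ℤ) (embOfAut τ₀ σ) := by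
  classical
  have h1 : Additive.toMul (alphaCharIn p 𝔭 τ₀ g) =
      ⟨weilGerm (primeLevel p 𝔭) (toWeilGroup τ₀ (alphaUnitIn p 𝔭 τ₀ g)), weilGerm_toWeilGroup_mem_weilLimitIn p τ₀ _⟩ :=
    Subtype.ext (by rw [coe_toMul_alphaCharIn]; exact (weilGerm_toWeilGroup_alphaUnitIn p 𝔭 τ₀ g).symm)
  rw [h1, fInvLim_mk]
  exact fInvHom_alphaUnitIn p 𝔭 τ₀ g w

end Germs

/-! ### §3 The diagram commutes: `Σ f(τ)τ ↦ Σ f(τ)(τD)` on `X^*(S^K)` is `π ↦ f_π` ∘ `X^*(α^K)` -/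

section Square

variable {K : Type} [Field K] [NumberField K] [IsCMField K] [IsGalois ℚ K]
variable (p : ℕ) [hp : Fact p.Prime] (𝔭 : Ideal (𝓞 K)) [h𝔭P : 𝔭.IsPrime] [h𝔭 : 𝔭.LiesOver (Ideal.span {(p : ℤ)})]
variable (τ₀ : K →ₐ[ℚ] cmNumbers)

omit [IsCMField K] hp in
/-- `σD = τD` iff `σw₀ = τw₀` (g18-#1 `cosetsEquivPrimesOver`). [cite: Milne1999, §6 p. 69 L16–L17] -/
theorem coe_eq_coe_iff_smul_eq (σ τ : K ≃ₐ[ℚ] K) :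
    (σ : (K ≃ₐ[ℚ] K) ⧸ decompositionGroup p 𝔭) = (τ : (K ≃ₐ[ℚ] K) ⧸ decompositionGroup p 𝔭) ↔
      σ • basePrime p 𝔭 = τ • basePrime p 𝔭 := by
  rw [← cosetsEquivPrimesOver_mk p 𝔭 σ, ← cosetsEquivPrimesOver_mk p 𝔭 τ, (cosetsEquivPrimesOver p 𝔭).injective.eq_iff]

/-- **LEMMA 5.1's DIAGRAM COMMUTES** («We have a commutative diagram (Lemma 5.1) … The first vertical map is `X^*(α^K)`, which maps `f` to
`π(f)`, and the second is `Σ f(τ)τ ↦ Σ f(τ)(τD)`»): for `g ∈ X^*(S^K)`, pushing `Σ_σ g(τ₀σ)σ ∈ ℤ[Γ]` forward to `ℤ[Γ/D]` (g16-#6 `pushFun`)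
gives `f_{π(g)}` on `Γ/D ≅ Y` — both have value `Σ_{σ ∈ τD} g(τ₀σ) = Σ_{σw₀ = τw₀} g(τ₀σ) = f_{π(g)}(τw₀)` at `τD` ((5.1)).
[cite: Milne1999, §6 p. 69 L18–L21, §5 p. 63 (5.1)] -/
theorem pushFun_toGroupRing (g : infinityTypes (cmNumbers ≃ₐ[ℚ] cmNumbers) (K →ₐ[ℚ] cmNumbers) cmNumbersConj) :
    pushFun ℤ ((↑) : (K ≃ₐ[ℚ] K) → (K ≃ₐ[ℚ] K) ⧸ decompositionGroup p 𝔭) (toGroupRing τ₀ (g : (K →ₐ[ℚ] cmNumbers) → ℤ)) =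
      germToCosetFun p 𝔭 τ₀ (alphaCharIn p 𝔭 τ₀ g) := by
  classical
  ext c
  induction c using QuotientGroup.induction_on with | H τ => ?_
  rw [CosetGerm.pushFun_apply_coe, germToCosetFun_apply_mk, toAdd_fInvLim_alphaCharIn]
  refine Finset.sum_congr ?_ fun σ _ => toGroupRing_apply τ₀ _ σ
  ext σ
  simp only [Finset.mem_filter, Finset.mem_univ, true_and, coe_eq_coe_iff_smul_eq]

/-- The same with `X^*(S^K) ≅ serreLattice` and g17-#3's `alphaS = push ∘ incl`: `alphaS (g) = f_{π(g)}`. [cite: Milne1999, §6 p. 69 L18–L21] -/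
theorem alphaS_serreLatticeEquiv (g : infinityTypes (cmNumbers ≃ₐ[ℚ] cmNumbers) (K →ₐ[ℚ] cmNumbers) cmNumbersConj) :
    alphaS (conjGal : K ≃ₐ[ℚ] K) (decompositionGroup p 𝔭) ℤ (serreLatticeEquiv τ₀ g) = germToCosetFun p 𝔭 τ₀ (alphaCharIn p 𝔭 τ₀ g) := by
  rw [CosetGerm.alphaS_apply, coe_serreLatticeEquiv, pushFun_toGroupRing]

/-- **The image of `π ↦ f_π` in `ℤ[Γ/D]` is g17-#3's `weilLattice`** (`= push(serreLattice)`): `⊆` because `X^*(α^K)` is onto `X^*(P^K)`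
(Lemma 5.1 / Remark 5.2 (a), g16-#3 `alphaCharIn_surjective`) and the square commutes; `⊇` because `X^*(S^K) ≅ serreLattice`.
[cite: Milne1999, §6 p. 69 L18–L21, §5 p. 63 Lemma 5.1, Remark 5.2] -/
theorem range_germToCosetFun :
    LinearMap.range (germToCosetFun p 𝔭 τ₀) = weilLattice (conjGal : K ≃ₐ[ℚ] K) (decompositionGroup p 𝔭) ℤ := by
  apply le_antisymm
  · rintro _ ⟨x, rfl⟩
    obtain ⟨g, rfl⟩ := alphaCharIn_surjective p 𝔭 τ₀ x
    exact ⟨serreLatticeEquiv τ₀ g, alphaS_serreLatticeEquiv p 𝔭 τ₀ g⟩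
  · rintro _ ⟨F, rfl⟩
    obtain ⟨g, rfl⟩ := (serreLatticeEquiv τ₀).surjective F
    exact ⟨alphaCharIn p 𝔭 τ₀ g, (alphaS_serreLatticeEquiv p 𝔭 τ₀ g).symm⟩

/-- `π ↦ f_π` lands in `weilLattice`. [cite: Milne1999, §6 p. 69 L18–L21] -/
theorem germToCosetFun_mem_weilLattice (x : Additive (weilLimitIn K p τ₀)) :
    germToCosetFun p 𝔭 τ₀ x ∈ weilLattice (conjGal : K ≃ₐ[ℚ] K) (decompositionGroup p 𝔭) ℤ := by
  rw [← range_germToCosetFun p 𝔭 τ₀]; exact LinearMap.mem_range_self _ x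

/-- `X^*(P^K) → weilLattice`, `ℤ`-linear. [cite: Milne1999, §6 p. 69 L18–L21] -/
def toWeilLattice : Additive (weilLimitIn K p τ₀) →ₗ[ℤ] weilLattice (conjGal : K ≃ₐ[ℚ] K) (decompositionGroup p 𝔭) ℤ :=
  (germToCosetFun p 𝔭 τ₀).codRestrict _ (germToCosetFun_mem_weilLattice p 𝔭 τ₀)

/-- [cite: Milne1999, §6 p. 69 L18–L21] -/
@[simp] theorem coe_toWeilLattice (x : Additive (weilLimitIn K p τ₀)) :
    (toWeilLattice p 𝔭 τ₀ x : (K ≃ₐ[ℚ] K) ⧸ decompositionGroup p 𝔭 →₀ ℤ) = germToCosetFun p 𝔭 τ₀ x := rfl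

/-- `X^*(P^K) → weilLattice` is a bijection. [cite: Milne1999, §6 p. 69 L18–L21] -/
theorem toWeilLattice_bijective : Function.Bijective (toWeilLattice p 𝔭 τ₀) := by
  constructor
  · intro x y h
    exact germToCosetFun_injective p 𝔭 τ₀ (congrArg (fun f : weilLattice (conjGal : K ≃ₐ[ℚ] K) (decompositionGroup p 𝔭) ℤ =>
      (f : (K ≃ₐ[ℚ] K) ⧸ decompositionGroup p 𝔭 →₀ ℤ)) h)
  · rintro ⟨F, hF⟩
    rw [← range_germToCosetFun p 𝔭 τ₀] at hF
    obtain ⟨x, rfl⟩ := hF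
    exact ⟨x, rfl⟩

/-- **`X^*(P^K) = W^K(p^∞) ≅ weilLattice`** (`ℤ`-linear equivalence): g16-#3's `X^*(P^K)` (germs of Weil numbers of `K`) IS the model's
`X^*(P^K) = CosetGerm.weilLattice conjGal D ℤ ⊂ ℤ[Γ/D]` of g17-#3 (Remark 5.2 (b): `[π] ↦ f_π` is an isomorphism onto the admissible
functions). [cite: Milne1999, §6 p. 69 L18–L21, §5 p. 63 Remark 5.2 (b)] -/
def weilLatticeEquiv : Additive (weilLimitIn K p τ₀) ≃ₗ[ℤ] weilLattice (conjGal : K ≃ₐ[ℚ] K) (decompositionGroup p 𝔭) ℤ :=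
  LinearEquiv.ofBijective (toWeilLattice p 𝔭 τ₀) (toWeilLattice_bijective p 𝔭 τ₀)

/-- [cite: Milne1999, §6 p. 69 L18–L21] -/
@[simp] theorem coe_weilLatticeEquiv (x : Additive (weilLimitIn K p τ₀)) :
    (weilLatticeEquiv p 𝔭 τ₀ x : (K ≃ₐ[ℚ] K) ⧸ decompositionGroup p 𝔭 →₀ ℤ) = germToCosetFun p 𝔭 τ₀ x := rfl

/-- **Under these identifications `X^*(α^K)` IS the model's `alphaP`**: `weilLatticeEquiv ∘ alphaCharIn = alphaP ∘ serreLatticeEquiv` — so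
g17-#3…#5's theorems about `alphaP` (the kernel of `X^*(α)`, Lemmas 6.7–6.10, the right-hand square, Theorem 6.1 at level `K` on characters)
are statements about `X^*(α^K) : X^*(S^K) → X^*(P^K)` of the CM field `K`. [cite: Milne1999, §6 p. 69 L18–L21 («The first vertical map is
X^*(α^K)»)] -/
theorem weilLatticeEquiv_alphaCharIn (g : infinityTypes (cmNumbers ≃ₐ[ℚ] cmNumbers) (K →ₐ[ℚ] cmNumbers) cmNumbersConj) :
    weilLatticeEquiv p 𝔭 τ₀ (alphaCharIn p 𝔭 τ₀ g) =
      alphaP (conjGal : K ≃ₐ[ℚ] K) (decompositionGroup p 𝔭) ℤ (serreLatticeEquiv τ₀ g) := by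
  apply Subtype.ext
  rw [coe_weilLatticeEquiv, CosetGerm.coe_alphaP, coe_serreLatticeEquiv, pushFun_toGroupRing]

/-- The square as an equality of `ℤ`-linear maps `X^*(S^K) → weilLattice`. [cite: Milne1999, §6 p. 69 L18–L21] -/
theorem weilLatticeEquiv_comp_alphaCharIn :
    (weilLatticeEquiv p 𝔭 τ₀).toLinearMap.comp (alphaCharIn p 𝔭 τ₀) =
      (alphaP (conjGal : K ≃ₐ[ℚ] K) (decompositionGroup p 𝔭) ℤ).comp (serreLatticeEquiv τ₀).toLinearMap :=
  LinearMap.ext fun g => weilLatticeEquiv_alphaCharIn p 𝔭 τ₀ g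

end Square

end CMNumbers

end Literature.NumberTheory.ComplexMultiplication
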